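import Mathlib
import Summits.ValiantsHypothesis.ValiantsHypothesis.Theorems.LacunarySymmetroidMatrixDescartesCensusRealExponentsTwoByTwoLocus

/-!
# `MatrixDescartes` census — corollaries: the `(2,6)` rows at every level over real exponents; counterexamples fill large shells

HONEST FRAMING.  Object-search cell `pub-symmetroid`, item `DoorA26 = PosRootLawAt 2 6 19`
(stmt-ValiantsHypothesis-19979; OPEN, typed, never asserted) and the `V = 19` row `PosRootLawAt 2 6 18`
(«no nineteen»; OPEN); pure corollaries of `…CensusRealExponentsTwoByTwo{,Locus}` and `…Simplex`,
deciding nothing.  Nothing here bears on `MatrixDescartes` (stmt-ValiantsHypothesis-18050) or `VP ≠ VNP`.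

* `posRootLawAt_two_iff_simplex` — every `(2, k+1, B)` row ⟺ its instances on the compact simplex
  `0 = δ₀ ≤ ⋯ ≤ δ_k = 1` (all `B`);
* `nineteenRow_two_six_iff_rpow`, `nineteenRow_two_six_iff_simplex` — the `V = 19` register statement
  `PosRootLawAt 2 6 18` («`ζ_sym(2,6) ≤ 18`») over real exponents / on the compact simplex;
* `not_doorA26_iff_eventually_shell`, `not_posRootLawAt_two_iff_eventually_shell` — **if a row fails, it
  fails in EVERY sufficiently large shell**: `¬ PosRootLawAt 2 (k+1) B` iff there is `N₀` such that for
  every `N ≥ N₀` some sorted support `0 = d₀ ≤ ⋯ ≤ d_k = N` carries a violating pencil (contrapositive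
  of «infinitely many shells suffice»).  So a finite census that finds no twenty (nineteen) in ONE large
  shell is consistent with the door only in the obvious direction; but a door FAILURE could not hide from
  all large shells.

[folklore] Pure logic on the companion files.
-/

-- `Summit.ValiantsHypothesis.ValiantsHypothesis.…` repeats a component by the D-0017 layout
-- (single-conjunct summit), which the `dupNamespace` linter flags; the name is mandated.
set_option linter.dupNamespace false

namespace Summit.ValiantsHypothesis.ValiantsHypothesis.Theorems.LacunarySymmetroidMatrixDescartes.Census.RealExp

open Finset
open scoped BigOperators Matrix
open Summit.ValiantsHypothesis.ValiantsHypothesis.Theorems.MatrixDescartes.Negative (PosRootLawAt)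

section Corollaries

/-- Every `2 × 2` row (any number of letters, any bound) is equivalent to its instances on the compact
simplex of normalised sorted real exponent vectors. [folklore] -/
theorem posRootLawAt_two_iff_simplex (k B : ℕ) :
    PosRootLawAt 2 (k + 1) B ↔ ∀ (δ : Fin (k + 1) → ℝ), Monotone δ → δ 0 = 0 → δ (Fin.last k) = 1 →
      ∀ (S : Fin (k + 1) → Matrix (Fin 2) (Fin 2) ℝ), (∀ l, (S l).IsSymm) →
        {x : ℝ | 0 < x ∧ (∑ l, (x ^ (δ l)) • S l).det = 0}.ncard ≤ B :=
  (posRootLawAt_two_iff_rpow (k + 1) B).trans realRow_iff_simplex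

/-- **The `V = 19` row over real exponents.**  `PosRootLawAt 2 6 18` («no real symmetric six-term
`2 × 2` pencil has 19 distinct positive det-roots», i.e. `ζ_sym(2,6) ≤ 18`; OPEN) holds iff every
REAL-exponent six-letter symmetric `2 × 2` pencil has at most `18` zeros on `(0,∞)`. [folklore] -/
theorem nineteenRow_two_six_iff_rpow :
    PosRootLawAt 2 6 18 ↔ ∀ (δ : Fin 6 → ℝ) (S : Fin 6 → Matrix (Fin 2) (Fin 2) ℝ), (∀ l, (S l).IsSymm) →
      {x : ℝ | 0 < x ∧ (∑ l, (x ^ (δ l)) • S l).det = 0}.ncard ≤ 18 :=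
  posRootLawAt_two_iff_rpow 6 18

/-- The `V = 19` row on the compact simplex `0 = δ₀ ≤ ⋯ ≤ δ₅ = 1`. [folklore] -/
theorem nineteenRow_two_six_iff_simplex :
    PosRootLawAt 2 6 18 ↔ ∀ (δ : Fin 6 → ℝ), Monotone δ → δ 0 = 0 → δ (Fin.last 5) = 1 →
      ∀ (S : Fin 6 → Matrix (Fin 2) (Fin 2) ℝ), (∀ l, (S l).IsSymm) →
        {x : ℝ | 0 < x ∧ (∑ l, (x ^ (δ l)) • S l).det = 0}.ncard ≤ 18 :=
  posRootLawAt_two_iff_simplex 5 18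

/-- The nineteen-locus of the `(2,6)` format is open in `ℝ⁶` (instance of `isOpen_realRow_two`).
[folklore] -/
theorem isOpen_nineteenLocus_two_six :
    IsOpen {δ : Fin 6 → ℝ | ∃ S : Fin 6 → Matrix (Fin 2) (Fin 2) ℝ, (∀ l, (S l).IsSymm) ∧
      19 ≤ {x : ℝ | 0 < x ∧ (∑ l, (x ^ (δ l)) • S l).det = 0}.ncard} :=
  isOpen_realRow_two (k := 5) (B := 18)

/-- **A failing `2 × 2` row fails in every large shell.**  `¬ PosRootLawAt 2 (k+1) B` iff there is `N₀`
such that every shell `N ≥ N₀` contains a sorted support `0 = d₀ ≤ ⋯ ≤ d_k = N` violating the row.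
[folklore] -/
theorem not_posRootLawAt_two_iff_eventually_shell (k B : ℕ) :
    ¬ PosRootLawAt 2 (k + 1) B ↔ ∃ N₀ : ℕ, ∀ N : ℕ, N₀ ≤ N → ∃ d : Fin (k + 1) → ℕ, Monotone d ∧ d 0 = 0 ∧
      d (Fin.last k) = N ∧ ¬ PosRootLawOn 2 (k + 1) B d := by
  constructor
  · intro h
    by_contra hne
    push Not at hne
    exact h (posRootLawAt_two_of_frequently_shell fun N₀ => by
      obtain ⟨N, hN₀, hN⟩ := hne N₀
      exact ⟨N, hN₀, fun d hd h0 h1 => hN d hd h0 h1⟩)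
  · rintro ⟨N₀, hN₀⟩ hlaw
    obtain ⟨d, -, -, -, hd⟩ := hN₀ N₀ le_rfl
    exact hd (fun S hS => hlaw d S hS)

/-- **If `DoorA26` fails, twenties occur in EVERY sufficiently large shell** `{0 = d₀ ≤ ⋯ ≤ d₅ = N}`.
[folklore] -/
theorem not_doorA26_iff_eventually_shell :
    ¬ DoorA26 ↔ ∃ N₀ : ℕ, ∀ N : ℕ, N₀ ≤ N → ∃ d : Fin 6 → ℕ, Monotone d ∧ d 0 = 0 ∧
      d (Fin.last 5) = N ∧ ¬ PosRootLawOn 2 6 19 d :=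
  not_posRootLawAt_two_iff_eventually_shell 5 19

end Corollaries

end Summit.ValiantsHypothesis.ValiantsHypothesis.Theorems.LacunarySymmetroidMatrixDescartes.Census.RealExp
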